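import Literature.Analysis.FluidPDE.FluidComputer.LatticeSymmetry
import Literature.Analysis.FluidPDE.FluidComputer.EnergyParseval

/-!
# MirrorWall — the faces of a mirror-symmetric periodic run are impermeable walls
# (FLUID COMPUTER cell, idea-1 gen 9: "calib1's level two is the lattice-forced image collision")

HONEST FRAMING: low prior, high value-of-information experiment on Tao's machine paradigm;
NOT a claim that NS blows up.

Dictionary (cell files `PREREG-R2.md` §10q–§10r, `PREREG-R2-READING.md` §8u, `atlas/IDEA-1.md` §13).
The calibration run `calib1` (two coaxial counter-rotating vortex rings, ring radius `R₀ = L/2π`, on the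
periodic box `[0, 2π)³`, evolved by a dealiased pseudo-spectral code = a Galerkin system
`ShellTransfer.IsGalerkinSolution` on a finite mode set `S`) has a datum that is invariant under the
lattice reflection `x ↦ -x` (`ShellTransfer.reflX`; a datum mirror-symmetric about the plane `x = π`
through the ring axis is `reflX`-invariant on the `2π`-lattice, the two reflections differing by a period).
This file types the elementary consequence the gen-9 reading rests on:

* `coeff_zero_reflX` : for a `reflX`-invariant coefficient field, `û₀(-k₀,k₁,k₂) = -û₀(k)`;
* `wave_reflX_face`  : on the planes `x = mπ` (`m : ℤ`) the plane wave is blind to the sign of `k₀`;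
* **`field_zero_on_faces`** : hence the truncated normal velocity `u_{S,0}(mπ, y, z) = 0` for every
  finite mode set `S` mapped into itself by `reflX` — the planes `x = 0` (the periodic FACE, half-way
  to the image ring) and `x = π` (the axis plane) are impermeable MIRROR WALLS of the truncated flow;
* **`faces_impermeable`** : by persistence of symmetry (`LatticeIsometry.act_eq_self`: equivariance +
  Galerkin uniqueness) this holds at ALL times of an unforced Galerkin run whose datum is
  `reflX`-invariant at one time — in the system the engines step, without imposing the symmetry.

So an expanding vortex ring of such a run cannot cross the face: it meets its mirror image there as an
anti-parallel pair (the classical vortex/wall ⇄ vortex/image dictionary), which is the cell's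
"second-generation collision by lattice symmetry" (u_z-takeover at `t_x ≈ 6.9`, seed-independent to
±0.3: P-G9-1 (b)).  The same statement with `reflY`, `reflZ` gives the other four faces.
0 sorry; finite-sum algebra over the tree's `LatticeSymmetry` / `ShellTransferParseval` API only.
Staged by planner seat pub-fluidc-idea-1 gen 9 (HOME/pub-fluidc-idea-1/lean/MirrorWall.lean); intended
home `Summits/NavierStokesRegularity/FluidComputer/MirrorWall.lean` (cell placement rule; filing is the
literature seat's call).
-/

noncomputable section

namespace Summit.NavierStokesRegularity.FluidComputer.MirrorWall

open Literature.Analysis.FluidPDE.FluidComputer ShellTransfer Complex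
open scoped BigOperators

/-- `e^{-i n (mπ)} = e^{i n (mπ)}`: at a half period the 1D mode is even in the wavenumber. -/
theorem mode_neg_halfPeriod (n m : ℤ) :
    mode (-n) ((m : ℝ) * Real.pi) = mode n ((m : ℝ) * Real.pi) := by
  unfold mode
  rw [Complex.exp_eq_exp_iff_exists_int]
  refine ⟨-(n * m), ?_⟩
  push_cast
  ring

/-- On the planes `x = mπ` the plane wave does not see the sign of `k₀`. -/
theorem wave_reflX_face (k : Fin 3 → ℤ) (m : ℤ) (y z : ℝ) :
    wave (reflX.invK k) ((m : ℝ) * Real.pi) y z = wave k ((m : ℝ) * Real.pi) y z := by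
  rw [reflX_invK]
  simp only [wave, Matrix.cons_val_zero, Matrix.cons_val_one, Matrix.head_cons, Matrix.cons_val_two,
    Matrix.tail_cons, mode_neg_halfPeriod]

/-- A `reflX`-invariant coefficient field has a normal component odd in `k₀`:
`û₀(Mᵀk) = -û₀(k)` with `Mᵀk = (-k₀, k₁, k₂)`. -/
theorem coeff_zero_reflX (A : FourierVelocity) (hA : reflX.act A = A) (k : Fin 3 → ℤ) :
    A.coeff (reflX.invK k) 0 = -A.coeff k 0 := by
  have h : (reflX.act A).coeff k 0 = A.coeff k 0 := by rw [hA]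
  rw [LatticeIsometry.act_coeff] at h
  -- `h : ∑ j, (reflX.M 0 j : ℂ) * A.coeff (reflX.invK k) j = A.coeff k 0`
  rw [← h]
  generalize A.coeff (reflX.invK k) = a
  simp [reflX, Fin.sum_univ_three]

/-- **The faces are mirror walls.** For a `reflX`-invariant coefficient field and a finite mode set mapped
into itself by `reflX`, the truncated normal velocity vanishes on every plane `x = mπ`:
`u_{S,0}(mπ, y, z) = Σ_{k∈S} û₀(k) e^{ik·x} = 0`. -/
theorem field_zero_on_faces (A : FourierVelocity) (hA : reflX.act A = A) {S : Finset (Fin 3 → ℤ)}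
    (hS : ∀ p ∈ S, reflX.invK p ∈ S) (m : ℤ) (y z : ℝ) :
    field A S 0 ((m : ℝ) * Real.pi) y z = 0 := by
  unfold field
  have hanti : ∀ k, A.coeff (reflX.invK k) 0 * wave (reflX.invK k) ((m : ℝ) * Real.pi) y z =
      -(A.coeff k 0 * wave k ((m : ℝ) * Real.pi) y z) := by
    intro k
    rw [coeff_zero_reflX A hA, wave_reflX_face]
    ring
  have hre := reflX.sum_comp_invK hS (fun k => A.coeff k 0 * wave k ((m : ℝ) * Real.pi) y z)
  simp only [hanti, Finset.sum_neg_distrib] at hre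
  -- `hre : -Σ = Σ`
  have h2 : (2 : ℂ) * ∑ p ∈ S, A.coeff p 0 * wave p ((m : ℝ) * Real.pi) y z = 0 := by
    linear_combination (-1 : ℂ) * hre
  exact (mul_eq_zero.mp h2).resolve_left two_ne_zero

/-- **Persistence: the faces stay impermeable for all times.** An unforced Galerkin solution supported in
a mode set mapped into itself by `reflX`, whose datum is `reflX`-invariant at one time `t₀`, has zero
normal velocity on the planes `x = mπ` at every time — the mirror walls of the vortex/image dictionary,
exact in the truncated system the engines integrate. -/
theorem faces_impermeable {U : ℝ → FourierVelocity} {S : Finset (Fin 3 → ℤ)} {ν : ℝ}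
    {c : ℝ → (Fin 3 → ℤ) → ℂ} (hU : IsGalerkinSolution U S ν c fun _ _ _ => 0)
    (hs : IsSupportedOn U S) (hS : ∀ p ∈ S, reflX.invK p ∈ S) (hS' : ∀ p ∈ S, reflX.actK p ∈ S)
    {t₀ : ℝ} (h0 : reflX.act (U t₀) = U t₀) (t : ℝ) (m : ℤ) (y z : ℝ) :
    field (U t) S 0 ((m : ℝ) * Real.pi) y z = 0 :=
  field_zero_on_faces (U t) (reflX.act_eq_self hU hs hS hS' h0 t) hS m y z

end Summit.NavierStokesRegularity.FluidComputer.MirrorWall
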